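import Mathlib
import Literature.Analysis.FluidPDE.LocalTypeI
import Literature.Analysis.FluidPDE.SuitableWeakInBallTools
import Literature.Analysis.FluidPDE.SuitableWeakRescaling
import Literature.Analysis.FluidPDE.LocalTypeIScaling
import Literature.Analysis.FluidPDE.CKNScalingExtras
import Literature.Analysis.FluidPDE.Seregin2023.PowerWeightEulerZoom
import HarnessLib

/-!
# Zoom tools for the conditional reduction of `EulerZoomLiouville.SereginZoomReduction`
# (route №10 `EulerZoomLiouville`, support item Z = stmt-NavierStokesRegularity-19834)

Helper file (theorems only; `--supports stmt-NavierStokesRegularity-19834`). Seat ns-typeII-p3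
(cell ns-regularity-ideate §B, D-0081; DIRECTOR-NS g6 #3: the Summits-side half of Z).

The support item Z restates G. Seregin, *On potential Type II blowups for the Navier–Stokes
equations*, arXiv:2606.29468, Thm 3.1 at `(s, l, κ, η) = (3, 3, 2, 0)`, `f(r) = r^ρ`, `0 < ρ ≤ 1/2`,
for a suitable weak solution `(v, q)` in an ARBITRARY parabolic ball `Q(z₀, r₀)`, with the CKN
quantities `cknA` (a genuine supremum in time) / `cknE` / `cknD` and the floor (3.1) as a space–time
integral over the windows `]t₀ − r^{2+ρ}, t₀[ × B(x₀, r)`.  The tree's named fact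
`Literature.Analysis.FluidPDE.Seregin2023.seregin2026_typeII_scenario_eulerLimit` is the printed theorem
in the UNIT cylinder `Q(0, 1)`.  This file carries piece (a) of the reduction (typeII-lit-1's list,
`Seregin2023/PowerWeightEulerZoom.lean` docstring): the Navier–Stokes zoom
`U(s, y) = λ v(t₀ + λ² s, x₀ + λ y)`, `P = λ² q ∘ Φ`, `G' = λ² G ∘ Φ`, `λ = min(r₀, 1)`, from
`Q(z₀, λ) ⊆ Q(z₀, r₀)` onto `Q(0, 1)`:
* `isSuitableWeakSolutionInBall_mono_radius` — Albritton–Barker's Def. 2.1 class restricts to a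
  smaller concentric parabolic ball (any centre; the tree's `isSuitableWeakSolutionInBall_of_le_radius`
  is the centre-`0` case);
* `cknA_nsZoom` — scale covariance of the GENUINE-supremum `A` (the tree has the essential-supremum
  form `cknAEss_nsZoom` and `cknE_nsZoom`, `cknC_nsZoom`, `cknD_nsZoom`);
* `gauge_zoom_le` — the power-gauged bound `r^{2ρ}A + r^ρ E + r^{2ρ} D ≤ M` on `]0, r₀]` at `z₀` gives
  the same bound with constant `λ^{−2ρ} M` on `]0, 1]` at the origin for the zoomed triple;
* `floor_zoom_le` — the floor is monotone under the zoom: the `U`-window at radius `r/λ` is the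
  `v`-window at radius `r` with the LONGER time length `λ^{−ρ} r^{2+ρ} ≥ r^{2+ρ}` (`λ ≤ 1`; the floor
  is not NS-covariant), and the prefactors combine to `λ^{−2ρ} ≥ 1`, so the same `ε₀` survives;
* `exists_floor_seq_of_lt_one` — typeII-lit-1's `exists_floor_seq` with the measurability hypothesis
  asked only on windows of radius `< 1` (those lie in `Q(0,1)`, where the zoomed field is known to be
  measurable).
WHAT THIS IS NOT: not NS regularity and not a proof of Seregin's theorem — bookkeeping for a
reduction modulo the typed printed fact. [folklore]
-/

noncomputable section

-- the summit and its single problem share the name `NavierStokesRegularity` (D-0017 nested layout)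
set_option linter.dupNamespace false

open Set Function Filter Topology MeasureTheory Metric TopologicalSpace
open scoped NNReal ENNReal InnerProductSpace RealInnerProductSpace

namespace Summit.NavierStokesRegularity.NavierStokesRegularity.Theorems.SereginZoomReduction

open Literature.Analysis Literature.Analysis.FluidPDE Literature.Analysis.FluidPDE.Seregin2023

/-! ## Restriction of A–B's class to a smaller concentric ball (any centre) -/

/-- **Albritton–Barker's Def. 2.1 class restricts to smaller concentric parabolic balls** (any centre
`z`): every clause is monotone in the region. [folklore] -/
theorem isSuitableWeakSolutionInBall_mono_radius {R R' : ℝ} {z : ℝ × EuclideanSpace ℝ (Fin 3)}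
    {u : ℝ → EuclideanSpace ℝ (Fin 3) → EuclideanSpace ℝ (Fin 3)} {p : ℝ → EuclideanSpace ℝ (Fin 3) → ℝ}
    (h : IsSuitableWeakSolutionInBall R' z u p) (hR : 0 < R) (hRR' : R ≤ R') :
    IsSuitableWeakSolutionInBall R z u p := by
  obtain ⟨hsw, ⟨C, hC⟩, ⟨G, hG, hG2⟩, hp⟩ := h
  have hI : Ioo (z.1 - R ^ 2) z.1 ⊆ Ioo (z.1 - R' ^ 2) z.1 := by
    refine Ioo_subset_Ioo ?_ le_rfl
    have : R ^ 2 ≤ R' ^ 2 := pow_le_pow_left₀ hR.le hRR' 2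
    linarith
  have hsub : parabolicCylinder R z ⊆ parabolicCylinder R' z := by
    unfold parabolicCylinder
    exact prod_mono hI (ball_subset_ball hRR')
  have hle : parabolicCylinderOpens R z ≤ parabolicCylinderOpens R' z := hsub
  refine ⟨hsw.of_le hle, ⟨C, ?_⟩, ⟨G, hG.mono hle, lt_of_le_of_lt (lintegral_mono_set hsub) hG2⟩,
    hp.mono_measure (Measure.restrict_mono hsub le_rfl)⟩
  filter_upwards [ae_restrict_of_ae_restrict_of_subset hI hC] with t ht
  exact (lintegral_mono_set (ball_subset_ball hRR')).trans ht

/-! ## Scale covariance of the genuine-supremum `A` -/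

/-- **Scale covariance of `A` (genuine supremum in time)**: `A(v_c; Q(z, r)) = A(v; Q(Φ z, c r))`
for `v_c(s, y) = c v(t₀ + c² s, x₀ + c y)`, `Φ(s, y) = (t₀ + c² s, x₀ + c y)`. [folklore] -/
theorem cknA_nsZoom {c r : ℝ} (hc : 0 < c) (hr : 0 < r) (t₀ : ℝ) (x₀ : EuclideanSpace ℝ (Fin 3))
    (z : ℝ × EuclideanSpace ℝ (Fin 3))
    (u : ℝ → EuclideanSpace ℝ (Fin 3) → EuclideanSpace ℝ (Fin 3)) :
    cknA r z (c • stPull (c ^ 2) c t₀ x₀ u) = cknA (c * r) (stAffine (c ^ 2) c t₀ x₀ z) u := by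
  have hc2 : 0 < c ^ 2 := by positivity
  unfold cknA
  have hg : ∀ t : ℝ, (ENNReal.ofReal r)⁻¹ *
      ∫⁻ x in ball z.2 r, ‖(c • stPull (c ^ 2) c t₀ x₀ u) t x‖ₑ ^ 2 =
      (ENNReal.ofReal (c * r))⁻¹ *
        ∫⁻ x in ball (x₀ + c • z.2) (c * r), ‖u (t₀ + c ^ 2 * t) x‖ₑ ^ 2 := by
    intro t
    simp only [Pi.smul_apply, stPull_apply]
    exact scaledL2_nsZoom hc hr x₀ z.2 (u (t₀ + c ^ 2 * t))
  simp_rw [hg]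
  rw [stAffine_fst, stAffine_snd]
  -- reindex the supremum along the time affinity `t ↦ t₀ + c² t`
  have himage : (fun t : ℝ => t₀ + c ^ 2 * t) '' Ioo (z.1 - r ^ 2) z.1 =
      Ioo (t₀ + c ^ 2 * z.1 - (c * r) ^ 2) (t₀ + c ^ 2 * z.1) := by
    ext τ
    simp only [mem_image, mem_Ioo]
    constructor
    · rintro ⟨t, ⟨h1, h2⟩, rfl⟩
      constructor <;> nlinarith
    · rintro ⟨h1, h2⟩
      refine ⟨(τ - t₀) / c ^ 2, ⟨?_, ?_⟩, ?_⟩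
      · rw [lt_div_iff₀ hc2]; nlinarith
      · rw [div_lt_iff₀ hc2]; nlinarith
      · field_simp
        ring
  rw [← himage, iSup_image]

/-! ## The zoom of the gauges and of the floor -/

/-- `Φ(0) = z₀` for the zoom centred at `z₀ = (t₀, x₀)`. [folklore] -/
theorem stAffine_zero (β γ : ℝ) (z₀ : ℝ × EuclideanSpace ℝ (Fin 3)) :
    stAffine β γ z₀.1 z₀.2 (0 : ℝ × EuclideanSpace ℝ (Fin 3)) = z₀ := by
  ext <;> simp [stAffine]

/-- **The power-gauged bound under the zoom.** If `r^{2ρ} A(r) + r^{ρ} E(r) + r^{2ρ} D(r) ≤ M` at `z₀`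
for `r ∈ ]0, r₀]` (`ρ ≥ 0`), then for `0 < λ ≤ min(r₀, 1)` the zoomed triple
`(λ v ∘ Φ, λ² q ∘ Φ, λ² G ∘ Φ)` obeys the same bound at the origin for `r ∈ ]0, 1]` with constant
`λ^{−2ρ} M` (`r^{2ρ} = λ^{−2ρ}(λr)^{2ρ}`, `r^{ρ} ≤ λ^{−2ρ} (λ r)^{ρ}`). [folklore] -/
theorem gauge_zoom_le {ρ lam r₀ : ℝ} (hρ : 0 ≤ ρ) (hlam : 0 < lam) (hlam1 : lam ≤ 1) (hlamr : lam ≤ r₀)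
    {z₀ : ℝ × EuclideanSpace ℝ (Fin 3)} {v : ℝ → EuclideanSpace ℝ (Fin 3) → EuclideanSpace ℝ (Fin 3)}
    {q : ℝ → EuclideanSpace ℝ (Fin 3) → ℝ}
    {G : ℝ → EuclideanSpace ℝ (Fin 3) → EuclideanSpace ℝ (Fin 3) →L[ℝ] EuclideanSpace ℝ (Fin 3)}
    {M : ℝ≥0}
    (hM : ∀ r ∈ Ioc (0 : ℝ) r₀,
      ENNReal.ofReal (r ^ (2 * ρ)) * cknA r z₀ v + ENNReal.ofReal (r ^ ρ) * cknE r z₀ G +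
        ENNReal.ofReal (r ^ (2 * ρ)) * cknD r z₀ q ≤ (M : ℝ≥0∞)) :
    ∀ r ∈ Ioc (0 : ℝ) 1,
      ENNReal.ofReal (r ^ (2 * ρ)) *
            cknA r (0 : ℝ × EuclideanSpace ℝ (Fin 3)) (lam • stPull (lam ^ 2) lam z₀.1 z₀.2 v) +
          ENNReal.ofReal (r ^ ρ) *
            cknE r (0 : ℝ × EuclideanSpace ℝ (Fin 3)) ((lam * lam) • stPull (lam ^ 2) lam z₀.1 z₀.2 G) +
          ENNReal.ofReal (r ^ (2 * ρ)) *
            cknD r (0 : ℝ × EuclideanSpace ℝ (Fin 3)) (lam ^ 2 • stPull (lam ^ 2) lam z₀.1 z₀.2 q) ≤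
        ENNReal.ofReal (lam ^ (-(2 * ρ))) * (M : ℝ≥0∞) := by
  intro r hr
  have hr0 : 0 < r := hr.1
  have hlr : lam * r ∈ Ioc (0 : ℝ) r₀ :=
    ⟨mul_pos hlam hr0, by nlinarith [hr.2]⟩
  rw [show lam * lam = lam ^ 2 by ring, cknA_nsZoom hlam hr0, cknE_nsZoom hlam hr0, cknD_nsZoom hlam hr0,
    stAffine_zero]
  -- compare the weights
  have hw2 : ENNReal.ofReal (r ^ (2 * ρ)) =
      ENNReal.ofReal (lam ^ (-(2 * ρ))) * ENNReal.ofReal ((lam * r) ^ (2 * ρ)) := by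
    rw [← ENNReal.ofReal_mul (Real.rpow_nonneg hlam.le _), Real.mul_rpow hlam.le hr0.le, ← mul_assoc,
      ← Real.rpow_add hlam]
    simp
  have hw1 : ENNReal.ofReal (r ^ ρ) ≤
      ENNReal.ofReal (lam ^ (-(2 * ρ))) * ENNReal.ofReal ((lam * r) ^ ρ) := by
    rw [← ENNReal.ofReal_mul (Real.rpow_nonneg hlam.le _), Real.mul_rpow hlam.le hr0.le, ← mul_assoc,
      ← Real.rpow_add hlam]
    refine ENNReal.ofReal_le_ofReal ?_
    have h1 : 1 ≤ lam ^ (-(2 * ρ) + ρ) := by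
      rw [show -(2 * ρ) + ρ = -ρ by ring]
      exact Real.one_le_rpow_of_pos_of_le_one_of_nonpos hlam hlam1 (by linarith)
    have h2 : 0 ≤ r ^ ρ := Real.rpow_nonneg hr0.le _
    nlinarith
  calc ENNReal.ofReal (r ^ (2 * ρ)) * cknA (lam * r) z₀ v +
        ENNReal.ofReal (r ^ ρ) * cknE (lam * r) z₀ G + ENNReal.ofReal (r ^ (2 * ρ)) * cknD (lam * r) z₀ q
      ≤ ENNReal.ofReal (lam ^ (-(2 * ρ))) * ENNReal.ofReal ((lam * r) ^ (2 * ρ)) * cknA (lam * r) z₀ v +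
          ENNReal.ofReal (lam ^ (-(2 * ρ))) * ENNReal.ofReal ((lam * r) ^ ρ) * cknE (lam * r) z₀ G +
          ENNReal.ofReal (lam ^ (-(2 * ρ))) * ENNReal.ofReal ((lam * r) ^ (2 * ρ)) *
            cknD (lam * r) z₀ q := by
        rw [← hw2]
        gcongr
    _ = ENNReal.ofReal (lam ^ (-(2 * ρ))) *
          (ENNReal.ofReal ((lam * r) ^ (2 * ρ)) * cknA (lam * r) z₀ v +
            ENNReal.ofReal ((lam * r) ^ ρ) * cknE (lam * r) z₀ G +
            ENNReal.ofReal ((lam * r) ^ (2 * ρ)) * cknD (lam * r) z₀ q) := by ring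
    _ ≤ ENNReal.ofReal (lam ^ (-(2 * ρ))) * (M : ℝ≥0∞) := mul_le_mul' le_rfl (hM _ hlr)

/-- **The floor (3.1) under the zoom.** For `0 < λ ≤ 1`, `ρ ≥ 0`, `r > 0` and
`U(s, y) = λ v(t₀ + λ² s, x₀ + λ y)`:
`r^{2ρ−2} ∫_{]t₀−r^{2+ρ},t₀[ × B(x₀,r)} |v|³ ≤ (r/λ)^{2ρ−2} ∫_{]−(r/λ)^{2+ρ},0[ × B(0,r/λ)} |U|³` — the
`U`-window at radius `r/λ` is the `v`-window at radius `r` with the longer time length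
`λ^{−ρ} r^{2+ρ}`, and `(r/λ)^{2ρ−2} · λ³ · (λ² λ³)⁻¹ = λ^{−2ρ} r^{2ρ−2} ≥ r^{2ρ−2}`. [folklore] -/
theorem floor_zoom_le {ρ lam : ℝ} (hρ : 0 ≤ ρ) (hlam : 0 < lam) (hlam1 : lam ≤ 1)
    (z₀ : ℝ × EuclideanSpace ℝ (Fin 3)) (v : ℝ → EuclideanSpace ℝ (Fin 3) → EuclideanSpace ℝ (Fin 3))
    {r : ℝ} (hr : 0 < r) :
    ENNReal.ofReal (r ^ (2 * ρ - 2)) *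
        ∫⁻ w in Ioo (z₀.1 - r ^ (2 + ρ)) z₀.1 ×ˢ ball z₀.2 r, ‖v w.1 w.2‖ₑ ^ (3 : ℕ) ≤
      ENNReal.ofReal ((r / lam) ^ (2 * ρ - 2)) *
        ∫⁻ w in Ioo ((0 : ℝ × EuclideanSpace ℝ (Fin 3)).1 - (r / lam) ^ (2 + ρ))
            (0 : ℝ × EuclideanSpace ℝ (Fin 3)).1 ×ˢ
            ball (0 : ℝ × EuclideanSpace ℝ (Fin 3)).2 (r / lam),
          ‖(lam • stPull (lam ^ 2) lam z₀.1 z₀.2 v) w.1 w.2‖ₑ ^ (3 : ℕ) := by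
  have hlam2 : 0 < lam ^ 2 := by positivity
  have hrl : 0 < r / lam := div_pos hr hlam
  -- the `U`-window is the preimage of the long `v`-window
  set T : ℝ := lam ^ 2 * (r / lam) ^ (2 + ρ) with hT
  have hpre : stAffine (lam ^ 2) lam z₀.1 z₀.2 ⁻¹' (Ioo (z₀.1 - T) z₀.1 ×ˢ ball z₀.2 r) =
      Ioo ((0 : ℝ × EuclideanSpace ℝ (Fin 3)).1 - (r / lam) ^ (2 + ρ))
        (0 : ℝ × EuclideanSpace ℝ (Fin 3)).1 ×ˢ ball (0 : ℝ × EuclideanSpace ℝ (Fin 3)).2 (r / lam) := by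
    rw [stAffine_preimage_cylinder hlam2 hlam]
    simp only [Prod.fst_zero, Prod.snd_zero, sub_self, smul_zero, zero_div]
    congr 2
    rw [hT]
    field_simp
    ring
  -- the time length of the long window dominates `r^{2+ρ}`
  have hTge : r ^ (2 + ρ) ≤ T := by
    rw [hT, Real.div_rpow hr.le hlam.le, mul_div_assoc', le_div_iff₀ (Real.rpow_pos_of_pos hlam _)]
    have h1 : lam ^ (2 + ρ) ≤ lam ^ (2 : ℝ) :=
      Real.rpow_le_rpow_of_exponent_ge hlam hlam1 (by linarith)
    have h1' : lam ^ (2 + ρ) ≤ lam ^ 2 := by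
      rw [show lam ^ 2 = lam ^ (2 : ℝ) by norm_cast]
      exact h1
    have h2 : 0 ≤ r ^ (2 + ρ) := Real.rpow_nonneg hr.le _
    calc r ^ (2 + ρ) * lam ^ (2 + ρ) ≤ r ^ (2 + ρ) * lam ^ 2 :=
          mul_le_mul_of_nonneg_left h1' h2
      _ = lam ^ 2 * r ^ (2 + ρ) := by ring
  have hsubw : Ioo (z₀.1 - r ^ (2 + ρ)) z₀.1 ×ˢ ball z₀.2 r ⊆ Ioo (z₀.1 - T) z₀.1 ×ˢ ball z₀.2 r :=
    prod_mono (Ioo_subset_Ioo (by linarith) le_rfl) Subset.rfl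
  -- change of variables
  have hF : (fun w : ℝ × EuclideanSpace ℝ (Fin 3) =>
      ‖(lam • stPull (lam ^ 2) lam z₀.1 z₀.2 v) w.1 w.2‖ₑ ^ (3 : ℕ)) =
      fun w => (fun w' : ℝ × EuclideanSpace ℝ (Fin 3) => ENNReal.ofReal lam ^ (3 : ℕ) * ‖v w'.1 w'.2‖ₑ ^ (3 : ℕ))
        (stAffine (lam ^ 2) lam z₀.1 z₀.2 w) := by
    funext w
    simp only [Pi.smul_apply, stPull_apply, stAffine_fst, stAffine_snd, enorm_smul, mul_pow,
      Real.enorm_eq_ofReal hlam.le]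
  rw [← hpre, hF, setLIntegral_preimage_comp_stAffine (E := EuclideanSpace ℝ (Fin 3)) hlam2 hlam z₀.1 z₀.2
      (fun w' : ℝ × EuclideanSpace ℝ (Fin 3) => ENNReal.ofReal lam ^ (3 : ℕ) * ‖v w'.1 w'.2‖ₑ ^ (3 : ℕ))
      (Ioo (z₀.1 - T) z₀.1 ×ˢ ball z₀.2 r),
    finrank_euclideanSpace_fin, lintegral_const_mul' _ _ (by simp)]
  -- collect the scalar factors: `(r/λ)^{2ρ-2} (λ² λ³)⁻¹ λ³ = λ^{-2ρ} r^{2ρ-2} ≥ r^{2ρ-2}`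
  have hscal : ENNReal.ofReal ((r / lam) ^ (2 * ρ - 2)) * (ENNReal.ofReal (lam ^ 2 * lam ^ 3)⁻¹ *
      ENNReal.ofReal lam ^ (3 : ℕ)) = ENNReal.ofReal (lam ^ (-(2 * ρ)) * r ^ (2 * ρ - 2)) := by
    rw [← ENNReal.ofReal_pow hlam.le, ← ENNReal.ofReal_mul (by positivity),
      ← ENNReal.ofReal_mul (by positivity)]
    congr 1
    rw [Real.div_rpow hr.le hlam.le, Real.rpow_sub hlam, Real.rpow_neg hlam.le,
      show lam ^ (2 : ℝ) = lam ^ 2 by norm_cast]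
    field_simp
  have hge : ENNReal.ofReal (r ^ (2 * ρ - 2)) ≤ ENNReal.ofReal (lam ^ (-(2 * ρ)) * r ^ (2 * ρ - 2)) := by
    refine ENNReal.ofReal_le_ofReal ?_
    have h1 : 1 ≤ lam ^ (-(2 * ρ)) :=
      Real.one_le_rpow_of_pos_of_le_one_of_nonpos hlam hlam1 (by linarith)
    have h2 : 0 ≤ r ^ (2 * ρ - 2) := Real.rpow_nonneg hr.le _
    nlinarith
  calc ENNReal.ofReal (r ^ (2 * ρ - 2)) *
        ∫⁻ w in Ioo (z₀.1 - r ^ (2 + ρ)) z₀.1 ×ˢ ball z₀.2 r, ‖v w.1 w.2‖ₑ ^ (3 : ℕ)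
      ≤ ENNReal.ofReal (lam ^ (-(2 * ρ)) * r ^ (2 * ρ - 2)) *
          ∫⁻ w in Ioo (z₀.1 - T) z₀.1 ×ˢ ball z₀.2 r, ‖v w.1 w.2‖ₑ ^ (3 : ℕ) :=
        mul_le_mul' hge (lintegral_mono_set hsubw)
    _ = ENNReal.ofReal ((r / lam) ^ (2 * ρ - 2)) * (ENNReal.ofReal (lam ^ 2 * lam ^ 3)⁻¹ *
          (ENNReal.ofReal lam ^ (3 : ℕ) *
            ∫⁻ w in Ioo (z₀.1 - T) z₀.1 ×ˢ ball z₀.2 r, ‖v w.1 w.2‖ₑ ^ (3 : ℕ))) := by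
        rw [← hscal]; ring

/-- **The floor of the zoomed field.** If `(v, z₀)` has the floor (3.1) — for every `δ > 0` some
`r ∈ ]0, δ[` with `ε₀ ≤ r^{2ρ−2} ∫_{]t₀−r^{2+ρ},t₀[×B(x₀,r)} |v|³` — then so has the zoomed field at the
origin, with the same `ε₀` (`0 < λ ≤ 1`, `ρ ≥ 0`). [folklore] -/
theorem floor_zoom {ρ lam ε₀ : ℝ} (hρ : 0 ≤ ρ) (hlam : 0 < lam) (hlam1 : lam ≤ 1)
    (z₀ : ℝ × EuclideanSpace ℝ (Fin 3)) (v : ℝ → EuclideanSpace ℝ (Fin 3) → EuclideanSpace ℝ (Fin 3))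
    (hfloor : ∀ δ : ℝ, 0 < δ → ∃ r ∈ Ioo (0 : ℝ) δ,
      ENNReal.ofReal ε₀ ≤ ENNReal.ofReal (r ^ (2 * ρ - 2)) *
        ∫⁻ w in Ioo (z₀.1 - r ^ (2 + ρ)) z₀.1 ×ˢ ball z₀.2 r, ‖v w.1 w.2‖ₑ ^ (3 : ℕ)) :
    ∀ δ : ℝ, 0 < δ → ∃ r ∈ Ioo (0 : ℝ) δ,
      ENNReal.ofReal ε₀ ≤ ENNReal.ofReal (r ^ (2 * ρ - 2)) *
        ∫⁻ w in Ioo ((0 : ℝ × EuclideanSpace ℝ (Fin 3)).1 - r ^ (2 + ρ))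
            (0 : ℝ × EuclideanSpace ℝ (Fin 3)).1 ×ˢ ball (0 : ℝ × EuclideanSpace ℝ (Fin 3)).2 r,
          ‖(lam • stPull (lam ^ 2) lam z₀.1 z₀.2 v) w.1 w.2‖ₑ ^ (3 : ℕ) := by
  intro δ hδ
  obtain ⟨r, hr, hle⟩ := hfloor (lam * δ) (mul_pos hlam hδ)
  refine ⟨r / lam, ⟨div_pos hr.1 hlam, by rw [div_lt_iff₀ hlam]; linarith [hr.2]⟩, ?_⟩
  exact hle.trans (floor_zoom_le hρ hlam hlam1 z₀ v hr.1)

/-! ## The floor sequence (measurability only inside the unit cylinder) -/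

/-- **From "small radii frequently" to a strictly decreasing null sequence** (recursive choice with
`δ_{k+1} = min(r_k, 1/(k+2))`; as in typeII-lit-1's `Seregin2023/PowerWeightEulerZoom.lean`). [folklore] -/
theorem exists_seq_strictAnti_of_frequently {P : ℝ → Prop}
    (h : ∀ δ : ℝ, 0 < δ → ∃ r ∈ Ioo (0 : ℝ) δ, P r) :
    ∃ r : ℕ → ℝ, (∀ k, r k ∈ Ioo (0 : ℝ) 1) ∧ StrictAnti r ∧ Tendsto r atTop (𝓝 0) ∧
      ∀ k, P (r k) := by
  classical
  let step : ℕ → ℝ → ℝ := fun k x =>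
    if hx : 0 < x then (h (min x (1 / ((k : ℝ) + 2))) (lt_min hx (by positivity))).choose else 0
  have hstep : ∀ (k : ℕ) (x : ℝ), 0 < x →
      step k x ∈ Ioo (0 : ℝ) (min x (1 / ((k : ℝ) + 2))) ∧ P (step k x) := by
    intro k x hx
    have hs : step k x = (h (min x (1 / ((k : ℝ) + 2))) (lt_min hx (by positivity))).choose := by
      simp only [step, dif_pos hx]
    rw [hs]
    exact (h (min x (1 / ((k : ℝ) + 2))) (lt_min hx (by positivity))).choose_spec
  obtain ⟨r₀, hr₀, hP₀⟩ := h 1 one_pos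
  let r : ℕ → ℝ := fun n => Nat.rec r₀ (fun k x => step k x) n
  have hr_zero : r 0 = r₀ := rfl
  have hr_succ : ∀ k, r (k + 1) = step k (r k) := fun k => rfl
  have hpos : ∀ k, 0 < r k := by
    intro k
    induction k with
    | zero => rw [hr_zero]; exact hr₀.1
    | succ k ih => rw [hr_succ]; exact (hstep k (r k) ih).1.1
  have hsucc : ∀ k, r (k + 1) < r k ∧ r (k + 1) < 1 / ((k : ℝ) + 2) ∧ P (r (k + 1)) := by
    intro k
    obtain ⟨hmem, hP⟩ := hstep k (r k) (hpos k)
    rw [hr_succ]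
    exact ⟨hmem.2.trans_le (min_le_left _ _), hmem.2.trans_le (min_le_right _ _), hP⟩
  have hanti : StrictAnti r := strictAnti_nat_of_succ_lt fun k => (hsucc k).1
  have hle : ∀ k, r k ≤ 1 / ((k : ℝ) + 1) := by
    intro k
    cases k with
    | zero => rw [hr_zero]; norm_num; exact hr₀.2.le
    | succ k =>
      have := (hsucc k).2.1
      push_cast
      rw [show (k : ℝ) + 1 + 1 = (k : ℝ) + 2 by ring]
      exact this.le
  refine ⟨r, fun k => ⟨hpos k, ?_⟩, hanti, ?_, fun k => ?_⟩
  · exact (hanti.antitone (Nat.zero_le k)).trans_lt (by rw [hr_zero]; exact hr₀.2)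
  · refine squeeze_zero (fun k => (hpos k).le) hle ?_
    exact tendsto_one_div_add_atTop_nhds_zero_nat
  · cases k with
    | zero => rw [hr_zero]; exact hP₀
    | succ k => exact (hsucc k).2.2

/-- **The floor (3.1) at the origin as the hypothesis of `seregin2026_typeII_scenario_eulerLimit` at
`(s, l, κ) = (3, 3, 2)`, `f = r^ρ`**, asking the measurability of the field only on the windows of
radius `< 1` (which lie in the unit cylinder). [folklore] -/
theorem exists_floor_seq_of_lt_one {ρ ε₀ : ℝ}
    (U : ℝ → EuclideanSpace ℝ (Fin 3) → EuclideanSpace ℝ (Fin 3))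
    (hmeas : ∀ r : ℝ, 0 < r → r < 1 → AEStronglyMeasurable (uncurry U)
      (volume.restrict (Ioo ((0 : ℝ × EuclideanSpace ℝ (Fin 3)).1 - r ^ (2 + ρ))
        (0 : ℝ × EuclideanSpace ℝ (Fin 3)).1 ×ˢ ball (0 : ℝ × EuclideanSpace ℝ (Fin 3)).2 r)))
    (hfloor : ∀ δ : ℝ, 0 < δ → ∃ r ∈ Ioo (0 : ℝ) δ,
      ENNReal.ofReal ε₀ ≤ ENNReal.ofReal (r ^ (2 * ρ - 2)) *
        ∫⁻ w in Ioo ((0 : ℝ × EuclideanSpace ℝ (Fin 3)).1 - r ^ (2 + ρ))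
            (0 : ℝ × EuclideanSpace ℝ (Fin 3)).1 ×ˢ ball (0 : ℝ × EuclideanSpace ℝ (Fin 3)).2 r,
          ‖U w.1 w.2‖ₑ ^ (3 : ℕ)) :
    ∃ r : ℕ → ℝ, (∀ k, r k ∈ Ioo (0 : ℝ) 1) ∧ StrictAnti r ∧ Tendsto r atTop (𝓝 0) ∧
      ∀ k, ENNReal.ofReal ε₀ ≤
        ENNReal.ofReal ((r k ^ ρ) ^ ((3 : ℝ) - 1)) *
          morreyMbar (fun s => s ^ ρ) (kappa 3 3) 3 3 (0 : ℝ × EuclideanSpace ℝ (Fin 3)) U (r k) := by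
  obtain ⟨r, hr, hanti, hlim, hP⟩ := exists_seq_strictAnti_of_frequently hfloor
  refine ⟨r, hr, hanti, hlim, fun k => ?_⟩
  rw [rpow_mul_morreyMbar_rpow_eq (hr k).1 (0 : ℝ × EuclideanSpace ℝ (Fin 3)) U
    (hmeas (r k) (hr k).1 (hr k).2)]
  exact hP k

/-- Windows of radius `r < 1` lie in the unit parabolic cylinder `Q(0, 1)` (`r^{2+ρ} ≤ 1` for
`ρ ≥ 0`). [folklore] -/
theorem window_subset_parabolicCylinder_one {ρ r : ℝ} (hρ : 0 ≤ ρ) (hr : 0 < r) (hr1 : r < 1) :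
    Ioo ((0 : ℝ × EuclideanSpace ℝ (Fin 3)).1 - r ^ (2 + ρ)) (0 : ℝ × EuclideanSpace ℝ (Fin 3)).1 ×ˢ
        ball (0 : ℝ × EuclideanSpace ℝ (Fin 3)).2 r ⊆
      parabolicCylinder 1 (0 : ℝ × EuclideanSpace ℝ (Fin 3)) := by
  unfold parabolicCylinder
  refine prod_mono (Ioo_subset_Ioo ?_ le_rfl) (ball_subset_ball hr1.le)
  have h1 : r ^ (2 + ρ) ≤ 1 := Real.rpow_le_one hr.le hr1.le (by linarith)
  simp only [Prod.fst_zero, one_pow]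
  linarith

/-- **Measurability of an A–B suitable weak solution on the small windows**: if `(U, P)` is a suitable
weak solution in `Q(0, 1)`, then `U` is a.e.-strongly measurable on every window of radius `r < 1`.
[folklore] -/
theorem aestronglyMeasurable_window {ρ : ℝ} (hρ : 0 ≤ ρ)
    {U : ℝ → EuclideanSpace ℝ (Fin 3) → EuclideanSpace ℝ (Fin 3)} {P : ℝ → EuclideanSpace ℝ (Fin 3) → ℝ}
    (hU : IsSuitableWeakSolutionInBall 1 (0 : ℝ × EuclideanSpace ℝ (Fin 3)) U P) :
    ∀ r : ℝ, 0 < r → r < 1 → AEStronglyMeasurable (uncurry U)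
      (volume.restrict (Ioo ((0 : ℝ × EuclideanSpace ℝ (Fin 3)).1 - r ^ (2 + ρ))
        (0 : ℝ × EuclideanSpace ℝ (Fin 3)).1 ×ˢ ball (0 : ℝ × EuclideanSpace ℝ (Fin 3)).2 r)) := by
  intro r hr hr1
  have h1 : AEStronglyMeasurable (uncurry U)
      (volume.restrict (parabolicCylinder 1 (0 : ℝ × EuclideanSpace ℝ (Fin 3)))) :=
    hU.1.distributional.1.aestronglyMeasurable
  exact h1.mono_set (window_subset_parabolicCylinder_one hρ hr hr1)

end Summit.NavierStokesRegularity.NavierStokesRegularity.Theorems.SereginZoomReduction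

end
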